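import Mathlib.Analysis.SpecialFunctions.Log.NegMulLog
import Mathlib.Analysis.SpecialFunctions.Pow.Deriv
import Mathlib.Analysis.Calculus.ParametricIntegral
import Mathlib.Analysis.Convex.Integral
import Mathlib.MeasureTheory.Integral.Bochner.ContinuousLinearMap
import Mathlib.MeasureTheory.Measure.LogLikelihoodRatio
import Literature.Geometry.GaugeTheory.AsdModuliSpace
import HarnessLib

/-!
# The instanton entropy `S_g : M_k(X, g) → ℝ` and its `L^p` cousins

Topic `Literature/Geometry/GaugeTheory`; definition request `defn-instantonEntropy` (route
`InstantonEntropy` of `SmoothPoincare4`, items `LocalMinRicPos`, `CollarMonotone`,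
`NoNeckConformal`, `RoundEntropyUnique`).

For a class `[A] ∈ M_k(X, g)` (`AsdModuliSpace g o k` of
`Literature.Geometry.GaugeTheory.AsdModuliSpace`) with curvature density
`ρ_A = |F_A|²_g : X → ℝ` (`AsdModuliSpace.density`), a non-negative function of total mass
`∫_X ρ_A dvol_g = 8π²k`, the **instanton entropy** `S_g[A] = ∫_X ρ_A log ρ_A dvol_g` (the Morse
function of idea card `instanton-entropy-mountain-pass`, §1; `0 log 0 = 0`, which is Lean's
`Real.log 0 = 0`) is ALREADY the tree's `AsdModuliSpace.entropy g hg : M_k(X, g) → ℝ`; this file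
does not redefine it (`instantonEntropy` below is a reducible alias carrying the requested name)
but supplies its API and its companions:

* `instantonLpPower g hg p [A] = f_p(A) := ∫_X ρ_A^{p/2} dvol_g = ‖F_A‖_{L^p}^p`, the `L^p`
  cousins (`p > 2` in the card; `f_2 = YM(A) = 8π²k`), with `S = 2 · ∂_p f_p |_{p=2}`
  (`hasDerivAt_instantonLpPower_two`);
* `AsdModuliSpace.entropy_eq_integral_llr`: `S_g[A]` is the relative entropy (Kullback–Leibler
  divergence, un-normalised) of the curvature measure `|F_A|²_g dvol_g` from `dvol_g`;
* `ymAction_mul_log_le_entropy`: `S_g[A] ≥ 8π²k log (8π²k / vol(X, g))` (Jensen);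

all through an abstract measure-theoretic layer — `densityEntropy μ ρ = ∫ ρ log ρ dμ` and
`densityLpPower μ ρ p = ∫ ρ^{p/2} dμ` for a measure `μ` and a real density `ρ`
(`AsdModuliSpace.entropy_eq_densityEntropy : S_g[A] = Ent_{dvol_g}(ρ_A)` is `rfl`) — in which the
elementary properties the route uses are *proved*:

* `densityEntropy_eq_integral_llr`: `Ent_μ(ρ) = ∫ log(dν/dμ) dν` for `ν = ρ μ` (Mathlib's
  log-likelihood ratio `MeasureTheory.llr`): the entropy *is* the relative entropy of the measure
  `ρ μ` with respect to the reference measure `μ`;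
* `hasDerivAt_densityLpPower_two`: for a bounded measurable density on a finite measure space,
  `p ↦ f_p` is differentiable at `p = 2` with derivative `S/2` (differentiation under the integral
  sign, dominated by `sup_{1≤p≤3} |ρ^{p/2} log ρ|`);
* `mass_mul_log_div_le_densityEntropy`: Jensen's inequality for the convex function `x log x`,
  `S ≥ m log (m / vol)` with `m = ∫ ρ dμ`, `vol = μ(X)` — the entropy is bounded below on a closed
  manifold in terms of the charge and the volume alone (card §1, "`S` is bounded below");
* `densityEntropy_withDensity_exp` / `densityEntropy_conformal`: under a change of reference
  measure `dμ' = e^{φ} dμ` with the density rescaled so that the measure `ρ dμ` is unchanged,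
  `ρ' = e^{-φ} ρ`, one has `S' = S - ∫ φ ρ dμ`. With `φ = 4u` this is the **conformal
  transformation law** of the instanton entropy in dimension four: for `g = e^{2u} g₀` the
  anti-self-duality equation and the measure `|F_A|²_g dvol_g` are conformally invariant
  (`|F|²_g = e^{-4u} |F|²_{g₀}`, `dvol_g = e^{4u} dvol_{g₀}`), so that `M_k(X, g) = M_k(X, g₀)` as
  sets and only the function moves: `S_g(A) = S_{g₀}(A) - 4 ∫_X u ρ_A^{g₀} dvol_{g₀}` (card §2, the
  "holographic formula"; in the flat/round model the one-instanton density
  `∝ λ⁴/(λ² + |x - x₀|²)⁴` *is* the bulk-to-boundary propagator `K₄` of hyperbolic 5-space,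
  Bianchi–Green–Kovacs–Rossi 1998, §6: "`ρ₀⁴/((x-x₀)² + ρ₀²)⁴ = K₄` is proportional to the
  instanton number density").

## Design notes

* The Riemannian measure `dvol_g` is `Literature.Geometry.Lorentzian.riemannianMeasure` of the
  `C^∞` Riemannian metric underlying `g` (positivity witness `hg : g.IsRiemannian`), on the Borel
  σ-algebra of `X`, packaged once as `volMeasure g hg` (the very measure integrated against in
  `SpOneConnection.ymAction` / `SpOneConnection.entropy`) so that the abstract lemmas apply
  verbatim; `instantonLpPower g hg 2 c` is the Yang–Mills action of the chosen representative
  (`instantonLpPower_two`).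
* As for `AsdModuliSpace.density` / `AsdModuliSpace.entropy`, `f_p` is evaluated on the
  representative `c.out` of a class; gauge invariance of `ρ_A` (`F ↦ u⁻¹ F u` preserves `|·|`)
  makes this independent of the representative (recorded in `AsdModuliSpace`, not re-proved).
* The analytic hypotheses of the proved lemmas (measurability and boundedness of `ρ_A`, finiteness
  and non-triviality of `dvol_g` on the closed manifold `X`) hold for smooth connections on a
  compact Riemannian 4-manifold; they are kept explicit because the corresponding statements about
  `riemannianMeasure` (`riemannianVolume_lt_top_of_isCompact`) and about the frame-wise density
  are vendored separately.
* What is **not** here: smoothness of `S` on `M_k^*` (Freed–Uhlenbeck 1984, Ch. 3: smooth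
  dependence of `F_A` on `A` in Kuranishi charts), the collar asymptotics `S = 32π² log(1/λ) + O(1)`
  (item `CollarMonotone`), the Hessian formula and every critical-point statement (items
  `LocalMinRicPos`, `NoNeckConformal`, `RoundEntropyUnique`) — the route's theses, not
  definitions.

## References

* Idea card `Summits/SmoothPoincare4/SmoothPoincare4/Ideas/instanton-entropy-mountain-pass.md`,
  §§1–2 (the functionals `S`, `f_p`, the conformal formula).
* S. K. Donaldson, P. B. Kronheimer, *The Geometry of Four-Manifolds* (1990), §2.1 (`|F_A|²`,
  `∫|F_A|² = 8π²k`, conformal invariance in dimension four). [DonaldsonKronheimer1990]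
* D. S. Freed, K. K. Uhlenbeck, *Instantons and Four-Manifolds* (1984), Ch. 3. [FreedUhlenbeck1984]
* M. Bianchi, M. B. Green, S. Kovacs, G. Rossi, JHEP 08 (1998) 013, §1 (the propagator `K_Δ`)
  and §6 (one-instanton density `= K₄`). [BianchiEtAl1998]
-/

noncomputable section

open scoped Manifold ContDiff Topology ENNReal
open Set Function MeasureTheory Filter
open Literature.Geometry.Lorentzian (PseudoRiemannianMetric riemannianMeasure)
open Literature.Topology.FourManifolds (SmoothOrientation)

namespace Literature.Geometry.GaugeTheory

/-! ### Entropy and `L^p` functionals of a density on a measure space -/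

section Density

variable {α : Type*} {m : MeasurableSpace α}

/-- The **Boltzmann–Shannon entropy of a density** `ρ` relative to the measure `μ`,
`Ent_μ(ρ) = ∫ ρ log ρ dμ` (Bochner integral; `0 log 0 = 0` since `Real.log 0 = 0`; junk value `0`
when `ρ log ρ` is not integrable). For a probability density this is minus the differential
entropy, i.e. the relative entropy of `ρ μ` with respect to `μ`. [folklore] -/
def densityEntropy (μ : Measure α) (ρ : α → ℝ) : ℝ :=
  ∫ x, ρ x * Real.log (ρ x) ∂μ

/-- The **`L^{p/2}`-power functional of a density**, `f_p(ρ) = ∫ ρ^{p/2} dμ` (real power `rpow`;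
for `ρ = |F|²` this is `‖F‖_{L^p}^p`). [folklore] -/
def densityLpPower (μ : Measure α) (ρ : α → ℝ) (p : ℝ) : ℝ :=
  ∫ x, ρ x ^ (p / 2) ∂μ

/-- **Entropy as relative entropy.** For a measurable density `ρ ≥ 0` on a σ-finite measure space,
`Ent_μ(ρ) = ∫ log (dν/dμ) dν` with `ν = ρ μ`, i.e. the integral of the log-likelihood ratio
`MeasureTheory.llr ν μ` against `ν` — the (un-normalised) Kullback–Leibler divergence of the
measure `ρ μ` from the reference measure `μ`. [folklore] -/
theorem densityEntropy_eq_integral_llr (μ : Measure α) [SigmaFinite μ] {ρ : α → ℝ}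
    (hρm : Measurable ρ) (hρ0 : ∀ x, 0 ≤ ρ x) :
    densityEntropy μ ρ =
      ∫ x, llr (μ.withDensity fun y ↦ ENNReal.ofReal (ρ y)) μ x
        ∂(μ.withDensity fun y ↦ ENNReal.ofReal (ρ y)) := by
  have hρm' : Measurable fun y ↦ ENNReal.ofReal (ρ y) := hρm.ennreal_ofReal
  rw [integral_withDensity_eq_integral_toReal_smul hρm'
    (Eventually.of_forall fun _ ↦ ENNReal.ofReal_lt_top), densityEntropy]
  refine integral_congr_ae ?_
  filter_upwards [Measure.rnDeriv_withDensity μ hρm'] with x hx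
  rw [llr, hx, ENNReal.toReal_ofReal (hρ0 x), smul_eq_mul]

/-- `f_2(ρ) = ∫ ρ dμ` is the total mass of the density (for `ρ = |F_A|²`: the Yang–Mills action).
[folklore] -/
theorem densityLpPower_two (μ : Measure α) (ρ : α → ℝ) :
    densityLpPower μ ρ 2 = ∫ x, ρ x ∂μ := by
  simp [densityLpPower]

/-- For `r ≥ 0`, `p ≠ 0`: `d/dp (r^{p/2}) = r^{p/2} log r / 2` (at `r = 0` both sides vanish). [folklore] -/
theorem hasDerivAt_rpow_half {r : ℝ} (hr : 0 ≤ r) {p : ℝ} (hp : p ≠ 0) :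
    HasDerivAt (fun q : ℝ ↦ r ^ (q / 2)) (r ^ (p / 2) * Real.log r / 2) p := by
  rcases hr.eq_or_lt with rfl | hr0
  · have h0 : (fun q : ℝ ↦ (0 : ℝ) ^ (q / 2)) =ᶠ[𝓝 p] fun _ ↦ 0 := by
      filter_upwards [eventually_ne_nhds hp] with q hq
      exact Real.zero_rpow (div_ne_zero hq two_ne_zero)
    rw [Real.log_zero, mul_zero, zero_div]
    exact (hasDerivAt_const p (0 : ℝ)).congr_of_eventuallyEq h0
  · have h : HasDerivAt (fun q : ℝ ↦ r ^ (q / 2)) (Real.log r * (1 / 2) * r ^ (p / 2)) p :=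
      ((hasDerivAt_id' p).div_const 2).const_rpow hr0
    exact h.congr_deriv (by ring)

/-- Uniform domination of the `p`-derivative of the integrand of `f_p` for `1 ≤ p ≤ 3` and a
density bounded by `C`: `|r^{p/2} log r| ≤ 2 + C'^{3/2} C'`, `C' = max C 1` (from
`|log x · x^{1/2}| < 2` on `(0,1]` and `log r ≤ r` on `[1, ∞)`). [folklore] -/
theorem abs_rpow_half_mul_log_le {r C p : ℝ} (hr : 0 ≤ r) (hrC : r ≤ C) (hp1 : 1 ≤ p)
    (hp3 : p ≤ 3) : |r ^ (p / 2) * Real.log r| ≤ 2 + max C 1 ^ ((3 : ℝ) / 2) * max C 1 := by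
  have hK : 0 ≤ max C 1 ^ ((3 : ℝ) / 2) * max C 1 := by positivity
  rcases hr.eq_or_lt with rfl | hr0
  · rw [Real.log_zero, mul_zero, abs_zero]
    linarith
  rcases le_or_gt r 1 with hr1 | hr1
  · have hq : (1 : ℝ) / 2 ≤ p / 2 := by linarith
    have h1 : r ^ (p / 2) ≤ r ^ ((1 : ℝ) / 2) := Real.rpow_le_rpow_of_exponent_ge hr0 hr1 hq
    have h2 : |Real.log r * r ^ ((1 : ℝ) / 2)| < 1 / (1 / 2) :=
      Real.abs_log_mul_self_rpow_lt r (1 / 2) hr0 hr1 (by norm_num)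
    calc |r ^ (p / 2) * Real.log r| = r ^ (p / 2) * |Real.log r| := by
          rw [abs_mul, abs_of_nonneg (Real.rpow_nonneg hr0.le _)]
      _ ≤ r ^ ((1 : ℝ) / 2) * |Real.log r| := by gcongr
      _ = |Real.log r * r ^ ((1 : ℝ) / 2)| := by
          rw [abs_mul, abs_of_nonneg (Real.rpow_nonneg hr0.le ((1 : ℝ) / 2)), mul_comm]
      _ ≤ 2 := by
          have h3 : (1 : ℝ) / (1 / 2) = 2 := by norm_num
          rw [h3] at h2
          exact h2.le
      _ ≤ 2 + max C 1 ^ ((3 : ℝ) / 2) * max C 1 := le_add_of_nonneg_right hK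
  · have hrC' : r ≤ max C 1 := hrC.trans (le_max_left _ _)
    have hlog : 0 ≤ Real.log r := Real.log_nonneg hr1.le
    have hlog' : Real.log r ≤ max C 1 :=
      (Real.log_le_sub_one_of_pos hr0).trans (by linarith)
    have h1 : r ^ (p / 2) ≤ r ^ ((3 : ℝ) / 2) :=
      Real.rpow_le_rpow_of_exponent_le hr1.le (by linarith)
    have h2 : r ^ ((3 : ℝ) / 2) ≤ max C 1 ^ ((3 : ℝ) / 2) :=
      Real.rpow_le_rpow hr0.le hrC' (by norm_num)
    calc |r ^ (p / 2) * Real.log r| = r ^ (p / 2) * Real.log r :=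
          abs_of_nonneg (mul_nonneg (Real.rpow_nonneg hr0.le _) hlog)
      _ ≤ max C 1 ^ ((3 : ℝ) / 2) * max C 1 :=
          mul_le_mul (h1.trans h2) hlog' hlog (by positivity)
      _ ≤ 2 + max C 1 ^ ((3 : ℝ) / 2) * max C 1 := by linarith

/-- **`S = 2 ∂_p f_p` at `p = 2`.** For a measurable density `0 ≤ ρ ≤ C` on a finite measure space,
`p ↦ f_p(ρ) = ∫ ρ^{p/2} dμ` is differentiable at `p = 2` with derivative `½ ∫ ρ log ρ dμ = ½ Ent_μ(ρ)`
(differentiation under the integral sign, dominated convergence via `abs_rpow_half_mul_log_le`).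
Idea card `instanton-entropy-mountain-pass`, §1 ("`S = ∂_p f_p` at `p = 2`", up to the factor `2`
coming from `f_p = ∫ (ρ)^{p/2}`). [folklore] -/
theorem hasDerivAt_densityLpPower_two (μ : Measure α) [IsFiniteMeasure μ] {ρ : α → ℝ} {C : ℝ}
    (hρm : Measurable ρ) (hρ0 : ∀ x, 0 ≤ ρ x) (hρC : ∀ x, ρ x ≤ C) :
    HasDerivAt (densityLpPower μ ρ) (densityEntropy μ ρ / 2) 2 := by
  set K : ℝ := 2 + max C 1 ^ ((3 : ℝ) / 2) * max C 1 with hK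
  have hs : Set.Ioo (1 : ℝ) 3 ∈ 𝓝 (2 : ℝ) := Ioo_mem_nhds (by norm_num) (by norm_num)
  have hF_meas : ∀ᶠ p in 𝓝 (2 : ℝ), AEStronglyMeasurable (fun x ↦ ρ x ^ (p / 2)) μ :=
    Eventually.of_forall fun p ↦ (hρm.pow_const _).aestronglyMeasurable
  have hF_int : Integrable (fun x ↦ ρ x ^ ((2 : ℝ) / 2)) μ := by
    have h22 : (2 : ℝ) / 2 = 1 := by norm_num
    simp only [h22, Real.rpow_one]
    refine Integrable.mono' (integrable_const C) hρm.aestronglyMeasurable (ae_of_all _ fun x ↦ ?_)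
    rw [Real.norm_eq_abs, abs_of_nonneg (hρ0 x)]
    exact hρC x
  have hF'_meas : AEStronglyMeasurable (fun x ↦ ρ x ^ ((2 : ℝ) / 2) * Real.log (ρ x) / 2) μ :=
    (((hρm.pow_const _).mul hρm.log).div_const 2).aestronglyMeasurable
  have h_bound : ∀ᵐ x ∂μ, ∀ p ∈ Set.Ioo (1 : ℝ) 3,
      ‖ρ x ^ (p / 2) * Real.log (ρ x) / 2‖ ≤ K / 2 := by
    refine ae_of_all _ fun x p hp ↦ ?_
    rw [Real.norm_eq_abs, abs_div, abs_two]
    exact div_le_div_of_nonneg_right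
      (abs_rpow_half_mul_log_le (hρ0 x) (hρC x) hp.1.le hp.2.le) zero_le_two
  have h_diff : ∀ᵐ x ∂μ, ∀ p ∈ Set.Ioo (1 : ℝ) 3,
      HasDerivAt (fun q : ℝ ↦ ρ x ^ (q / 2)) (ρ x ^ (p / 2) * Real.log (ρ x) / 2) p :=
    ae_of_all _ fun x p hp ↦ hasDerivAt_rpow_half (hρ0 x) (by linarith [hp.1])
  have hmain := (hasDerivAt_integral_of_dominated_loc_of_deriv_le hs hF_meas hF_int hF'_meas
    h_bound (integrable_const _) h_diff).2
  have h22 : (2 : ℝ) / 2 = 1 := by norm_num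
  simp only [h22, Real.rpow_one] at hmain
  rw [integral_div] at hmain
  exact hmain

/-- **Jensen: the entropy is bounded below by the mass and the volume.** On a finite, non-zero
measure space, for an integrable density `ρ ≥ 0` with `ρ log ρ` integrable and total mass
`m = ∫ ρ dμ`: `m · log (m / μ(X)) ≤ Ent_μ(ρ)` (convexity of `x log x`, `Real.convexOn_mul_log`, and
`ConvexOn.map_average_le`). For `ρ = |F_A|²` on a closed 4-manifold, `m = 8π²k`: the instanton
entropy is bounded below on `M_k(X, g)` (idea card `instanton-entropy-mountain-pass`, §1). [folklore] -/
theorem mass_mul_log_div_le_densityEntropy (μ : Measure α) [IsFiniteMeasure μ] [NeZero μ]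
    {ρ : α → ℝ} (hρ0 : ∀ x, 0 ≤ ρ x) (hρi : Integrable ρ μ)
    (hρlog : Integrable (fun x ↦ ρ x * Real.log (ρ x)) μ) :
    (∫ x, ρ x ∂μ) * Real.log ((∫ x, ρ x ∂μ) / μ.real univ) ≤ densityEntropy μ ρ := by
  have hJ := Real.convexOn_mul_log.map_average_le Real.continuous_mul_log.continuousOn
    isClosed_Ici (ae_of_all μ fun x ↦ Set.mem_Ici.2 (hρ0 x)) hρi hρlog
  have hV : 0 < μ.real univ := by
    rw [measureReal_def, ENNReal.toReal_pos_iff]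
    exact ⟨Measure.measure_univ_pos.2 (NeZero.ne μ), measure_lt_top μ _⟩
  rw [average_eq, average_eq, smul_eq_mul, smul_eq_mul] at hJ
  rw [densityEntropy]
  set I := ∫ x, ρ x ∂μ
  set J := ∫ x, ρ x * Real.log (ρ x) ∂μ
  have hJ' := mul_le_mul_of_nonneg_left hJ hV.le
  have h1 : μ.real univ * ((μ.real univ)⁻¹ * J) = J := by
    rw [← mul_assoc, mul_inv_cancel₀ hV.ne', one_mul]
  have h2 : μ.real univ * ((μ.real univ)⁻¹ * I * Real.log ((μ.real univ)⁻¹ * I)) =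
      I * Real.log (I / μ.real univ) := by
    rw [← mul_assoc, ← mul_assoc, mul_inv_cancel₀ hV.ne', one_mul, inv_mul_eq_div]
  rw [h1, h2] at hJ'
  exact hJ'

/-- **Change of reference measure.** If `dμ' = e^{φ} dμ` and the density is rescaled so that the
measure `ρ dμ` is unchanged, `ρ' = e^{-φ} ρ`, then `Ent_{μ'}(ρ') = Ent_μ(ρ) - ∫ φ ρ dμ`
(pointwise `e^{φ} · e^{-φ}ρ · log (e^{-φ}ρ) = ρ log ρ - φ ρ`, including where `ρ = 0`). [folklore] -/
theorem densityEntropy_withDensity_exp (μ : Measure α) {ρ φ : α → ℝ} (hφm : Measurable φ)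
    (hρlog : Integrable (fun x ↦ ρ x * Real.log (ρ x)) μ)
    (hφρ : Integrable (fun x ↦ φ x * ρ x) μ) :
    densityEntropy (μ.withDensity fun x ↦ ENNReal.ofReal (Real.exp (φ x)))
        (fun x ↦ Real.exp (-φ x) * ρ x) =
      densityEntropy μ ρ - ∫ x, φ x * ρ x ∂μ := by
  unfold densityEntropy
  rw [integral_withDensity_eq_integral_toReal_smul (by fun_prop)
    (Eventually.of_forall fun _ ↦ ENNReal.ofReal_lt_top)]
  have key : ∀ x, (ENNReal.ofReal (Real.exp (φ x))).toReal •
      (Real.exp (-φ x) * ρ x * Real.log (Real.exp (-φ x) * ρ x)) =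
        ρ x * Real.log (ρ x) - φ x * ρ x := by
    intro x
    rw [ENNReal.toReal_ofReal (Real.exp_pos _).le, smul_eq_mul]
    by_cases hρ : ρ x = 0
    · simp [hρ]
    · rw [Real.log_mul (Real.exp_pos _).ne' hρ, Real.log_exp]
      have hee : Real.exp (φ x) * Real.exp (-φ x) = 1 := by
        rw [← Real.exp_add, add_neg_cancel, Real.exp_zero]
      calc Real.exp (φ x) * (Real.exp (-φ x) * ρ x * (-φ x + Real.log (ρ x)))
            = (Real.exp (φ x) * Real.exp (-φ x)) * (ρ x * (-φ x + Real.log (ρ x))) := by ring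
        _ = ρ x * Real.log (ρ x) - φ x * ρ x := by rw [hee]; ring
  simp_rw [key]
  exact integral_sub hρlog hφρ

/-- The rescaled density has the same total mass against the rescaled measure:
`∫ e^{-φ}ρ d(e^{φ}μ) = ∫ ρ dμ` (for `φ = 4u`: conformal invariance of the Yang–Mills action in
dimension four). [folklore] -/
theorem integral_exp_neg_mul_withDensity_exp (μ : Measure α) {φ : α → ℝ} (hφm : Measurable φ)
    (ρ : α → ℝ) :
    ∫ x, Real.exp (-φ x) * ρ x ∂(μ.withDensity fun x ↦ ENNReal.ofReal (Real.exp (φ x))) =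
      ∫ x, ρ x ∂μ := by
  rw [integral_withDensity_eq_integral_toReal_smul (by fun_prop)
    (Eventually.of_forall fun _ ↦ ENNReal.ofReal_lt_top)]
  refine integral_congr_ae (ae_of_all _ fun x ↦ ?_)
  simp only
  rw [ENNReal.toReal_ofReal (Real.exp_pos _).le, smul_eq_mul, ← mul_assoc, ← Real.exp_add,
    add_neg_cancel, Real.exp_zero, one_mul]

/-- **Conformal transformation law of the entropy (card §2).** With `φ = 4u`: if
`dvol_g = e^{4u} dvol_{g₀}` and `ρ^{g} = e^{-4u} ρ^{g₀}` (the weights of the volume form and of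
`|F|²` under `g = e^{2u} g₀` in dimension four), then
`S_g = S_{g₀} - 4 ∫ u ρ^{g₀} dvol_{g₀}`. [folklore] -/
theorem densityEntropy_conformal (μ : Measure α) {ρ u : α → ℝ} (hum : Measurable u)
    (hρlog : Integrable (fun x ↦ ρ x * Real.log (ρ x)) μ)
    (huρ : Integrable (fun x ↦ u x * ρ x) μ) :
    densityEntropy (μ.withDensity fun x ↦ ENNReal.ofReal (Real.exp (4 * u x)))
        (fun x ↦ Real.exp (-(4 * u x)) * ρ x) =
      densityEntropy μ ρ - 4 * ∫ x, u x * ρ x ∂μ := by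
  have h4 : Integrable (fun x ↦ 4 * u x * ρ x) μ := by
    simpa [mul_assoc] using huρ.const_mul 4
  rw [densityEntropy_withDensity_exp μ (hum.const_mul 4) hρlog h4, ← integral_const_mul]
  simp_rw [mul_assoc]

end Density

/-! ### The functionals on the moduli space `M_k(X, g)` -/

section Moduli

variable {X : Type*} [TopologicalSpace X] [ChartedSpace (EuclideanSpace ℝ (Fin 4)) X]
  [IsManifold (𝓡 4) ∞ X] [T3Space X] [Nonempty X]
  (g : PseudoRiemannianMetric (𝓡 4) ∞ (EuclideanSpace ℝ (Fin 4)) (TangentSpace (𝓡 4) : X → Type _))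
  {o : SmoothOrientation (𝓡 4) X} {k : ℤ}

/-- The **Riemannian volume measure `dvol_g`** of the Riemannian metric underlying `g`
(positivity witness `hg`), on the Borel σ-algebra of `X`: the tree's `riemannianMeasure`
(Euclidean-normalised top-dimensional Hausdorff measure of the length metric), exactly the measure
integrated against in `SpOneConnection.ymAction` / `SpOneConnection.entropy`. [folklore] -/
def volMeasure (hg : g.IsRiemannian) : @Measure X (borel X) :=
  letI : MeasurableSpace X := borel X
  haveI : BorelSpace X := ⟨rfl⟩
  riemannianMeasure (g.toContMDiffRiemannianMetric hg)

/-- **The instanton entropy `S_g : M_k(X, g) → ℝ` is already in the tree** as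
`AsdModuliSpace.entropy g hg : M_k(X, g) → ℝ`, `S_g[A] = ∫_X ρ_A log ρ_A dvol_g`
(`ρ_A = |F_A|²_g` = `AsdModuliSpace.density`, evaluated on a representative; `0 log 0 = 0`). This
lemma reads it through the abstract functional: `S_g[A] = Ent_{dvol_g}(ρ_A)` (definitional), so
that every lemma of the `Density` section applies to it. [folklore] -/
theorem AsdModuliSpace.entropy_eq_densityEntropy (hg : g.IsRiemannian) (c : AsdModuliSpace g o k) :
    c.entropy g hg = densityEntropy (volMeasure g hg) (c.density g) :=
  rfl

/-- Unfolding: `S_g[A] = ∫_X ρ_A log ρ_A dvol_g` against `volMeasure g hg`. [folklore] -/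
theorem AsdModuliSpace.entropy_eq_integral (hg : g.IsRiemannian) (c : AsdModuliSpace g o k) :
    c.entropy g hg = ∫ x, c.density g x * Real.log (c.density g x) ∂(volMeasure g hg) :=
  rfl

/-- **`S_g` is a relative entropy**: if `dvol_g` is σ-finite and `ρ_A` is Borel measurable, then
`S_g[A] = ∫ log (dν_A/dvol_g) dν_A` for the curvature measure `ν_A = |F_A|²_g dvol_g` — the
(un-normalised, mass `8π²k`) Kullback–Leibler divergence of `ν_A` from the Riemannian volume, as
the definition request phrases it ("the Shannon entropy of the curvature density relative to the
Riemannian volume"). [folklore] -/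
theorem AsdModuliSpace.entropy_eq_integral_llr (hg : g.IsRiemannian) (c : AsdModuliSpace g o k)
    (hσ : SigmaFinite (volMeasure g hg)) (hm : Measurable[borel X] (c.density g)) :
    c.entropy g hg =
      ∫ x, llr ((volMeasure g hg).withDensity fun y ↦ ENNReal.ofReal (c.density g y))
          (volMeasure g hg) x
        ∂((volMeasure g hg).withDensity fun y ↦ ENNReal.ofReal (c.density g y)) :=
  densityEntropy_eq_integral_llr (volMeasure g hg) hm c.density_nonneg

/-- `instantonEntropy g hg` is an **alias** (`abbrev`, reducible) of the tree's
`AsdModuliSpace.entropy g hg : M_k(X, g) → ℝ`, provided only because the definition request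
`defn-instantonEntropy` and the route items `LocalMinRicPos` / `CollarMonotone` refer to the
functional under this name; it introduces no new object, and all lemmas are stated for
`AsdModuliSpace.entropy`. [folklore] -/
abbrev instantonEntropy (hg : g.IsRiemannian) (c : AsdModuliSpace g o k) : ℝ := c.entropy g hg

/-- **The `L^p` cousins `f_p : M_k(X, g) → ℝ`** of the entropy, `f_p[A] = ∫_X ρ_A^{p/2} dvol_g =
‖F_A‖_{L^p(g)}^p` (`ρ_A = |F_A|²_g`; meant for `p ≥ 2`, `f_2 = YM = 8π²k` on `M_k`). Idea card
`instanton-entropy-mountain-pass`, §1. [folklore] -/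
def instantonLpPower (hg : g.IsRiemannian) (p : ℝ) (c : AsdModuliSpace g o k) : ℝ :=
  densityLpPower (volMeasure g hg) (c.density g) p

/-- `f_2[A] = ∫_X |F_A|²_g dvol_g` is the Yang–Mills action of (a representative of) the class,
`= 8π²k` for ASD connections on `P_k` (Donaldson–Kronheimer 1990, §2.1). [folklore] -/
theorem instantonLpPower_two (hg : g.IsRiemannian) (c : AsdModuliSpace g o k) :
    instantonLpPower g hg 2 c = c.out.1.ymAction g hg := by
  rw [instantonLpPower, densityLpPower_two]
  rfl

/-- **`S = 2 ∂_p f_p |_{p=2}` on the moduli space**: if the curvature density of `[A]` is Borel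
measurable and bounded and `dvol_g` is finite (all automatic for a smooth instanton on a closed
Riemannian 4-manifold), then `p ↦ f_p[A]` has derivative `S_g[A] / 2` at `p = 2`. [folklore] -/
theorem hasDerivAt_instantonLpPower_two (hg : g.IsRiemannian) (c : AsdModuliSpace g o k) {C : ℝ}
    (hfin : IsFiniteMeasure (volMeasure g hg)) (hm : Measurable[borel X] (c.density g))
    (hC : ∀ x, c.density g x ≤ C) :
    HasDerivAt (fun p ↦ instantonLpPower g hg p c) (c.entropy g hg / 2) 2 :=
  hasDerivAt_densityLpPower_two (volMeasure g hg) hm (c.density_nonneg) hC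

/-- **The instanton entropy is bounded below by charge and volume**: if `dvol_g` is finite and
non-zero and `ρ_A`, `ρ_A log ρ_A` are integrable, then
`f_2[A] · log (f_2[A] / vol(X, g)) ≤ S_g[A]`; with `f_2 = 8π²k` on `M_k` this is the lower bound
`8π²k log (8π²k / vol(X,g))` of idea card `instanton-entropy-mountain-pass`, §1 (Jensen). [folklore] -/
theorem ymAction_mul_log_le_entropy (hg : g.IsRiemannian) (c : AsdModuliSpace g o k)
    (hfin : IsFiniteMeasure (volMeasure g hg)) (hne : NeZero (volMeasure g hg))
    (hi : Integrable (c.density g) (volMeasure g hg))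
    (hlog : Integrable (fun x ↦ c.density g x * Real.log (c.density g x)) (volMeasure g hg)) :
    instantonLpPower g hg 2 c *
        Real.log (instantonLpPower g hg 2 c / (volMeasure g hg).real univ) ≤
      c.entropy g hg := by
  rw [instantonLpPower, densityLpPower_two]
  exact mass_mul_log_div_le_densityEntropy (volMeasure g hg) (c.density_nonneg) hi hlog

end Moduli

end Literature.Geometry.GaugeTheory
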